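import Summits.KontsevichZagierPeriods.Zeta5Search.Certificates.RayC1KernelStepTailSharp
import HarnessLib

/-!
# ζ(5) search — certificates: PERIODIC window tables of the ray RayC1 below `θ = 1` — entries, checkers, soundness at EVERY shift (CERT-1 g6)

HONEST FRAMING: systematic search; no irrationality claim unless certified.  `p`-adic bookkeeping of explicit rationals; nothing
here is a statement about `ζ(5)`; every exponent this feeds is `< 1` (calibration ladder of the T1-map ray C1; λ* = 108.2193 is the
certified tie; no crossing claimed).

OUR work (Summit side; cert-1 seat, generation 6; offered INBOX 2026-08-21T23:23Z, consumer side of the lead's (S2) "θ ≤ 1 period").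
Below `θ = p/n = 1` write `n/p = m + ω`, `m = ⌊n/p⌋ ≥ 1`, `ω = {n/p}`.  Two kinds of savings of the ray are PERIODIC in `ω` — valid at
EVERY shift `m` with the SAME exponent:
* the brick cells (typer g16's 772 `ν`-cells `c1Cells`, `cell_brick_shift_c1`: `p^{2c} ∣` both numerators), and
* fam-rv g17's PERIODIC CLASS-LAW cells (`RVPeriodicWindows.PWin`: ONE window theorem per `ω`-cell for every `m ≥ 1`, Casoratian floor
  `B₁ − 256·m`), whose kernel exponent `k = 9 + 2·v_p(N♯) + B` is `m`-FREE because `v_p(N♯)` grows by exactly `128·m`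
  (`28+30+33+36+33+30−32−30`) and `v_p(ρ)` by `256·m` (`449 − 193`) along the cell (`vNlo0`, `vRhi0` below are the `m`-free parts).
So below `θ = 1` a table need not list windows shift by shift: a PERIODIC TABLE lists `ω`-cells `[u, v)` with a weight `w` and a source
(kind `6` = inside brick cell `j`, `w ≤ 2c_j`; kind `4` = inside periodic class cell `j` of a list `pw`, `w ≤ 9 + 2·vNlo0 + B₁` and
`w ≤ 9 + 2·vNlo0 − vRhi0`), and ONE truncated periodic step factor consumes it at all shifts `m₁ ≤ m ≤ K(n)` (sequel
`RayC1KernelPeriodic`).  This file: the cut-off `Kp n = ⌊√(n/86)⌋ − 1` (every prime has `p² > 86n ≥ 85n + 2`, the single-digit range of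
all valuation laws used), `periodic_prime_facts`, the `m`-free integer parts `pL`/`pU` (`pL_le`, `le_pU`) and `vNlo0`/`vRhi0`, the soundness
notion `PSound ok NT` ("every passing entry is a cell `0 < u < v ≤ 1` whose window primes at EVERY shift `1 ≤ m ≤ Kp(n)`, `n ≥ NT`, carry
`p^w ∣ wedgeNumZ ∧ p^w ∣ qNumZ`"), `psound_or`/`psound_mono`, and the BRICK kind: `pBrickCond` (decidable), **`psound_brick`**
(`cell_brick_shift_c1` at the shift `m = ⌊n/p⌋`).  The CLASS kind (`pClassCond`, `psound_class` under fam-rv's `∀ c ∈ pw, PWin.Holds c`) is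
the sequel `RayC1KernelPeriodicClass`.
-/

noncomputable section

open Finset

namespace Summit.KontsevichZagierPeriods.Zeta5Search.RayC1

open Summit.KontsevichZagierPeriods.Zeta5Search.DualSeries
open Summit.KontsevichZagierPeriods.Zeta5Search.DualSeriesDenominators
open Summit.KontsevichZagierPeriods.Zeta5Search.WedgeDictionary
open Summit.KontsevichZagierPeriods.Zeta5Search.RayKernel
open Summit.KontsevichZagierPeriods.Zeta5Search.Denom.DigitCert
open Summit.KontsevichZagierPeriods.Zeta5Search.CasoratianValuation (casoratian shift)
open Literature.NumberTheory.Irrationality.Hata1992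

/-! ### The cut-off and the primes of a periodic window -/

/-- The cut-off of the periodic shifts: `Kp(n) = ⌊√(n/86)⌋ − 1` (so that every prime used has `p² > 86n ≥ 85n + 2`). -/
def Kp (n : ℕ) : ℕ := Nat.sqrt (n / 86) - 1

/-- **Every prime of the truncated range is in the single-digit range**: `1 ≤ m ≤ Kp(n)` and `n < (m+1)·p` give `86·n < p²`. -/
theorem sq_gt_of_le_Kp {n m p : ℕ} (hm1 : 1 ≤ m) (hm : m ≤ Kp n) (hnp : n < (m + 1) * p) : 86 * n < p ^ 2 := by
  unfold Kp at hm
  set s := Nat.sqrt (n / 86) with hs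
  have hs2 : s * s ≤ n / 86 := Nat.sqrt_le (n / 86)
  have hs3 : 86 * (s * s) ≤ n := by
    have := Nat.div_mul_le_self n 86
    nlinarith
  rcases Nat.eq_zero_or_pos p with hp | hp
  · subst hp; simp at hnp
  rcases Nat.eq_zero_or_pos n with hn | hn
  · subst hn; positivity
  have hms : m + 1 ≤ s := by omega
  have h1 : n < s * p := lt_of_lt_of_le hnp (Nat.mul_le_mul_right p hms)
  have h2 : n * n < (s * s) * (p * p) := by nlinarith
  have h3 : 86 * (n * n) < n * (p * p) := by nlinarith
  have h4 : 86 * n < p * p := by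
    by_contra hcon
    rw [not_lt] at hcon
    have : n * (p * p) ≤ 86 * (n * n) := by nlinarith
    omega
  simpa [pow_two] using h4

/-- `Kp(n) → ∞`. -/
theorem tendsto_Kp : Filter.Tendsto Kp Filter.atTop Filter.atTop := by
  refine Filter.tendsto_atTop_atTop.2 fun b => ⟨86 * ((b + 1) * (b + 1)), fun n hn => ?_⟩
  unfold Kp
  have h1 : (b + 1) * (b + 1) ≤ n / 86 := (Nat.le_div_iff_mul_le (by norm_num)).2 (by linarith)
  have h2 : b + 1 ≤ Nat.sqrt (n / 86) := Nat.le_sqrt.2 h1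
  omega

/-- The facts every periodic certificate needs about a prime `p` of the `ω`-cell `[u, v)` at shift `m` (`1 ≤ m ≤ Kp n`, `1 ≤ n`):
`p` prime, `p ∤ n`, `85 < p`, `p ≤ n`, `86n < p²`, and the cell inequalities `(m+u)·p ≤ n < (m+v)·p` over `ℚ`. -/
theorem periodic_prime_facts {u v : ℚ} (hu : 0 < u) (huv : u < v) (hv1 : v ≤ 1) {n m p : ℕ} (hn : 1 ≤ n) (hm1 : 1 ≤ m)
    (hm : m ≤ Kp n) (hp : p ∈ windowPrimes (1 / ((m : ℝ) + ((v : ℚ) : ℝ))) (1 / ((m : ℝ) + ((u : ℚ) : ℝ))) n) :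
    p.Prime ∧ ¬ p ∣ n ∧ 85 < p ∧ p ≤ n ∧ 86 * n < p ^ 2 ∧ ((m : ℚ) + u) * p ≤ n ∧ (n : ℚ) < ((m : ℚ) + v) * p := by
  have hur : (0 : ℝ) < ((u : ℚ) : ℝ) := by exact_mod_cast hu
  have huvr : ((u : ℚ) : ℝ) < ((v : ℚ) : ℝ) := by exact_mod_cast huv
  obtain ⟨hpr, hlo, hhi⟩ := (mem_fracWindowPrimes_iff hur huvr).1 hp
  have hp0 : 0 < p := hpr.pos
  have hp0r : (0 : ℝ) < p := by exact_mod_cast hp0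
  have hlo1 : ((m : ℝ) + ((u : ℚ) : ℝ)) * p ≤ n := (le_div_iff₀ hp0r).1 hlo
  have hhi1 : (n : ℝ) < ((m : ℝ) + ((v : ℚ) : ℝ)) * p := (div_lt_iff₀ hp0r).1 hhi
  have hloq : ((m : ℚ) + u) * p ≤ n := by exact_mod_cast hlo1
  have hhiq : (n : ℚ) < ((m : ℚ) + v) * p := by exact_mod_cast hhi1
  have hmq : (1 : ℚ) ≤ m := by exact_mod_cast hm1
  have hnp : n < (m + 1) * p := by
    have h : (n : ℚ) < ((m : ℚ) + 1) * p := by nlinarith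
    exact_mod_cast h
  have hpn : p ≤ n := by
    have h : (p : ℚ) ≤ n := by nlinarith
    exact_mod_cast h
  have hsq : 86 * n < p ^ 2 := sq_gt_of_le_Kp hm1 hm hnp
  have hp85 : 85 < p := by nlinarith
  have hnd : ¬ p ∣ n := by
    rintro ⟨q, hq⟩
    have hq' : (n : ℚ) = (p : ℚ) * q := by exact_mod_cast hq
    rw [hq'] at hloq hhiq
    have hpq : (0 : ℚ) < p := by exact_mod_cast hp0
    have h1 : (m : ℚ) < q := by nlinarith
    have h2 : (q : ℚ) < m + 1 := by nlinarith
    have h1' : m < q := by exact_mod_cast h1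
    have h2' : q < m + 1 := by exact_mod_cast h2
    omega
  exact ⟨hpr, hnd, hp85, hpn, hsq, hloq, hhiq⟩

/-! ### Integer parts along a periodic cell: the `m`-free parts -/

/-- Lower `m`-free part of `⌊c·n/p⌋` on the cell: `⌊c·u⌋`. -/
def pL (c : ℕ) (u : ℚ) : ℤ := ⌊(c : ℚ) * u⌋

/-- Upper `m`-free part of `⌊c·n/p⌋` on the cell: `⌈c·v⌉ − 1`. -/
def pU (c : ℕ) (v : ℚ) : ℤ := ⌈(c : ℚ) * v⌉ - 1

/-- `c·m + ⌊c·u⌋ ≤ ⌊c·n/p⌋` when `(m+u)·p ≤ n`. -/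
theorem pL_le {c : ℕ} {u : ℚ} {n m p : ℕ} (hp : 0 < p) (hlo : ((m : ℚ) + u) * p ≤ n) :
    (c : ℤ) * m + pL c u ≤ ((c * n / p : ℕ) : ℤ) := by
  unfold pL
  set X : ℕ := c * n / p with hX
  have hfl : ((⌊(c : ℚ) * u⌋ : ℤ) : ℚ) ≤ (c : ℚ) * u := Int.floor_le _
  have hc0 : (0 : ℚ) ≤ c := Nat.cast_nonneg c
  have hp0 : (0 : ℚ) ≤ p := Nat.cast_nonneg p
  have h1 : ((((c : ℤ) * m + ⌊(c : ℚ) * u⌋ : ℤ)) : ℚ) * p ≤ ((c * n : ℕ) : ℚ) := by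
    push_cast
    have h2 : (((c : ℚ) * m + ((⌊(c : ℚ) * u⌋ : ℤ) : ℚ))) * p ≤ ((c : ℚ) * m + c * u) * p :=
      mul_le_mul_of_nonneg_right (by linarith) hp0
    have h3 : ((c : ℚ) * m + c * u) * p = c * (((m : ℚ) + u) * p) := by ring
    nlinarith
  have h2 : ((c : ℤ) * m + ⌊(c : ℚ) * u⌋) * (p : ℤ) ≤ ((c * n : ℕ) : ℤ) := by exact_mod_cast h1
  have h3 := Int.le_ediv_of_mul_le (by exact_mod_cast hp : (0 : ℤ) < p) h2
  rw [hX]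
  push_cast at h3 ⊢
  exact h3

/-- `⌊c·n/p⌋ ≤ c·m + ⌈c·v⌉ − 1` when `n < (m+v)·p` (`c > 0`). -/
theorem le_pU {c : ℕ} (hc : 0 < c) {v : ℚ} {n m p : ℕ} (hp : 0 < p) (hhi : (n : ℚ) < ((m : ℚ) + v) * p) :
    ((c * n / p : ℕ) : ℤ) ≤ (c : ℤ) * m + pU c v := by
  unfold pU
  set X : ℕ := c * n / p with hX
  have hp0 : (0 : ℚ) < p := by exact_mod_cast hp
  have hc0 : (0 : ℚ) < c := by exact_mod_cast hc
  have hce : (c : ℚ) * v ≤ ((⌈(c : ℚ) * v⌉ : ℤ) : ℚ) := Int.le_ceil _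
  have hfloor : (X : ℚ) * p ≤ (c : ℚ) * n := by
    have := Nat.div_mul_le_self (c * n) p
    have h' : ((X * p : ℕ) : ℚ) ≤ ((c * n : ℕ) : ℚ) := by exact_mod_cast this
    push_cast at h'
    exact h'
  have h2 : (c : ℚ) * n < (c : ℚ) * (((m : ℚ) + v) * p) := by nlinarith
  have h3 : (X : ℚ) < (c : ℚ) * ((m : ℚ) + v) := by
    by_contra hcon
    rw [not_lt] at hcon
    have := mul_le_mul_of_nonneg_right hcon hp0.le
    nlinarith
  have h4 : (X : ℚ) < (((c : ℤ) * m + ⌈(c : ℚ) * v⌉ : ℤ) : ℚ) := by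
    push_cast; nlinarith
  have h5 : (X : ℤ) < (c : ℤ) * m + ⌈(c : ℚ) * v⌉ := by exact_mod_cast h4
  omega

/-- The `m`-free part of the lower bound of `v_p(N♯(b))` on a cell `[u, v)` (the six numerator blocks `28,30,33,36,33,30` at `u`, the two
denominator blocks `32,30` at `v`); along the cell `v_p(N♯) ≥ 128·m + vNlo0`. -/
def vNlo0 (u v : ℚ) : ℤ := pL 28 u + pL 30 u + pL 33 u + pL 36 u + pL 33 u + pL 30 u - pU 32 v - pU 30 v

/-- The `m`-free part of the upper bound of `v_p(ρ(a·n))` on a cell (fifteen numerator blocks at `v`, six denominator blocks at `u`); along the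
cell `v_p(ρ) ≤ 256·m + vRhi0`. -/
def vRhi0 (u v : ℚ) : ℤ :=
  (pU 18 v + pU 20 v + pU 23 v + pU 25 v + pU 23 v + pU 26 v + pU 28 v + pU 31 v + pU 28 v + pU 33 v + pU 35 v + pU 38 v + pU 38 v +
      pU 40 v + pU 43 v) - (pL 35 u + pL 27 u + pL 25 u + pL 22 u + pL 20 u + pL 64 u)

/-! ### Entries and checkers -/

/-- Default brick cell for out-of-range indices (never passes the checks that matter). -/
def cellDefault : Cell := ⟨0, 1, 0, 1, 0, []⟩

/-- **Brick branch** for a periodic entry `(u, v, w, 8·j + 6)` (decidable): `[u, v)` inside the open `x`-interval of the brick cell `c1Cells[j]`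
(a sane cell: `0 < a₀`, `a₀b₁ < a₁b₀`, `a₁ ≤ b₁`, `0 < b₀ ≤ 85`, `0 < b₁ ≤ 85`, `0 ≤ c`), `u < v`, and `w ≤ 2c`. -/
def pBrickCond (e : WinEntry) : Bool :=
  decide (e.2.2.2 % 8 = 6) && decide (e.2.2.2 / 8 < c1Cells.length) &&
  (let C := c1Cells.getD (e.2.2.2 / 8) cellDefault
   decide (0 < C.a0) && decide (C.a0 * (C.b1 : ℤ) < C.a1 * (C.b0 : ℤ)) && decide (C.a1 ≤ (C.b1 : ℤ)) &&
   decide (0 < C.b0) && decide (C.b0 ≤ 85) && decide (0 < C.b1) && decide (C.b1 ≤ 85) && decide (0 ≤ C.c) &&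
   decide ((C.a0 : ℚ) / (C.b0 : ℚ) ≤ e.1) && decide (e.2.1 ≤ (C.a1 : ℚ) / (C.b1 : ℚ)) && decide (e.1 < e.2.1) &&
   decide ((e.2.2.1 : ℤ) ≤ 2 * C.c))

/-- **Soundness of a periodic checker from `NT`**: every passing entry is a cell `0 < u < v ≤ 1`, and for every `n ≥ NT`, every shift
`1 ≤ m ≤ Kp n` and every prime `p` with `⌊n/p⌋ = m`, `{n/p} ∈ [u, v)`: `p^w ∣ wedgeNumZ b b′` and `p^w ∣ qNumZ b b′` (`b = bC1 n`). -/
def PSound (ok : WinEntry → Bool) (NT : ℕ) : Prop :=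
  ∀ e : WinEntry, ok e = true → (0 < e.1 ∧ e.1 < e.2.1 ∧ e.2.1 ≤ 1) ∧
    ∀ n : ℕ, NT ≤ n → ∀ m : ℕ, 1 ≤ m → m ≤ Kp n →
      ∀ p ∈ windowPrimes (1 / ((m : ℝ) + ((e.2.1 : ℚ) : ℝ))) (1 / ((m : ℝ) + ((e.1 : ℚ) : ℝ))) n,
        (p : ℤ) ^ e.2.2.1 ∣ wedgeNumZ (bC1 n) (bC1' n) ∧ (p : ℤ) ^ e.2.2.1 ∣ qNumZ (bC1 n) (bC1' n)

/-- Sound periodic checkers combine by `||`. -/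
theorem psound_or {ok₁ ok₂ : WinEntry → Bool} {NT : ℕ} (h₁ : PSound ok₁ NT) (h₂ : PSound ok₂ NT) :
    PSound (fun e => ok₁ e || ok₂ e) NT := by
  intro e h
  rw [Bool.or_eq_true] at h
  rcases h with h | h
  · exact h₁ e h
  · exact h₂ e h

/-- A sound periodic checker stays sound from any later `NT′ ≥ NT`. -/
theorem psound_mono {ok : WinEntry → Bool} {NT NT' : ℕ} (h : PSound ok NT) (hle : NT ≤ NT') : PSound ok NT' :=
  fun e he => ⟨(h e he).1, fun n hn m hm1 hm p hp => (h e he).2 n (le_trans hle hn) m hm1 hm p hp⟩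

/-! ### Soundness of the brick branch -/

/-- Unpacking the brick branch. -/
theorem pBrickCond_sound {e : WinEntry} (h : pBrickCond e = true) :
    ∃ C : Cell, C ∈ c1Cells ∧ 0 < C.a0 ∧ C.a0 * (C.b1 : ℤ) < C.a1 * (C.b0 : ℤ) ∧ C.a1 ≤ (C.b1 : ℤ) ∧ 0 < C.b0 ∧ C.b0 ≤ 85 ∧
      0 < C.b1 ∧ C.b1 ≤ 85 ∧ 0 ≤ C.c ∧ (C.a0 : ℚ) / (C.b0 : ℚ) ≤ e.1 ∧ e.2.1 ≤ (C.a1 : ℚ) / (C.b1 : ℚ) ∧ e.1 < e.2.1 ∧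
      (e.2.2.1 : ℤ) ≤ 2 * C.c := by
  simp only [pBrickCond, Bool.and_eq_true, decide_eq_true_eq, and_assoc] at h
  obtain ⟨-, hlen, h1, h2, h3, h4, h5, h6, h7, h8, h9, h10, h11, h12⟩ := h
  refine ⟨c1Cells.getD (e.2.2.2 / 8) cellDefault, ?_, h1, h2, h3, h4, h5, h6, h7, h8, h9, h10, h11, h12⟩
  rw [List.getD_eq_getElem _ _ hlen]
  exact List.getElem_mem hlen

/-- **`pBrickCond` is sound from any `NT ≥ 1`** (`cell_brick_shift_c1` at the shift `m = ⌊n/p⌋`). -/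
theorem psound_brick {NT : ℕ} (hNT : 1 ≤ NT) : PSound pBrickCond NT := by
  intro e he
  obtain ⟨C, hC, ha0, huv, ha1b1, hb0, hb085, hb1, hb185, hc0, hu, hv, hlt, hw⟩ := pBrickCond_sound he
  have hb0q : (0 : ℚ) < C.b0 := by exact_mod_cast hb0
  have hb1q : (0 : ℚ) < C.b1 := by exact_mod_cast hb1
  have hUpos : (0 : ℚ) < (C.a0 : ℚ) / (C.b0 : ℚ) := div_pos (by exact_mod_cast ha0) hb0q
  have hV1 : (C.a1 : ℚ) / (C.b1 : ℚ) ≤ 1 := by rw [div_le_one hb1q]; exact_mod_cast ha1b1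
  have he1 : 0 < e.1 := lt_of_lt_of_le hUpos hu
  have he3 : e.2.1 ≤ 1 := le_trans hv hV1
  refine ⟨⟨he1, hlt, he3⟩, fun n hn m hm1 hm p hp => ?_⟩
  obtain ⟨hpr, hnd, hp85, hpn, hsq, hlo, hhi⟩ := periodic_prime_facts he1 hlt he3 (le_trans hNT hn) hm1 hm hp
  have hn1 : 1 ≤ n := le_trans hNT hn
  have hp0 : 0 < p := hpr.pos
  have hpB : p ≤ 85 * n := by omega
  have hsq85 : 85 * n < p ^ 2 := by omega
  -- the open cell in `x = n/p − m`, over `ℤ`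
  have hlo2 : ((m : ℚ) * C.b0 + C.a0) * p ≤ (n : ℚ) * C.b0 := by
    have h1 : ((m : ℚ) + (C.a0 : ℚ) / C.b0) * p ≤ ((m : ℚ) + e.1) * p :=
      mul_le_mul_of_nonneg_right (by linarith) (Nat.cast_nonneg p)
    have h2 := mul_le_mul_of_nonneg_right (h1.trans hlo) hb0q.le
    calc ((m : ℚ) * C.b0 + C.a0) * p = ((m : ℚ) + (C.a0 : ℚ) / C.b0) * p * C.b0 := by field_simp
      _ ≤ (n : ℚ) * C.b0 := h2
  have hhi2 : (n : ℚ) * C.b1 < ((m : ℚ) * C.b1 + C.a1) * p := by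
    have h1 : ((m : ℚ) + e.2.1) * p ≤ ((m : ℚ) + (C.a1 : ℚ) / C.b1) * p :=
      mul_le_mul_of_nonneg_right (by linarith) (Nat.cast_nonneg p)
    have h2 := mul_lt_mul_of_pos_right (lt_of_lt_of_le hhi h1) hb1q
    calc (n : ℚ) * C.b1 < ((m : ℚ) + (C.a1 : ℚ) / C.b1) * p * C.b1 := h2
      _ = ((m : ℚ) * C.b1 + C.a1) * p := by field_simp
  have hloZ : ((m : ℤ) * C.b0 + C.a0) * p ≤ (n : ℤ) * C.b0 := by exact_mod_cast hlo2
  have hhiZ : (n : ℤ) * C.b1 < ((m : ℤ) * C.b1 + C.a1) * p := by exact_mod_cast hhi2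
  have hx1 : (C.b1 : ℤ) * ((n : ℤ) - m * p) < C.a1 * (p : ℤ) := by linarith
  have hx0' : C.a0 * (p : ℤ) ≤ (C.b0 : ℤ) * ((n : ℤ) - m * p) := by linarith
  have hx0 : C.a0 * (p : ℤ) < (C.b0 : ℤ) * ((n : ℤ) - m * p) := by
    rcases hx0'.lt_or_eq with hlt' | heq
    · exact hlt'
    · exfalso
      have hpZ : Prime (p : ℤ) := Nat.prime_iff_prime_int.1 hpr
      have hdvd : (p : ℤ) ∣ (C.b0 : ℤ) * ((n : ℤ) - m * p) := ⟨C.a0, by linarith⟩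
      rcases hpZ.dvd_mul.1 hdvd with h | h
      · have h' : p ∣ C.b0 := by exact_mod_cast h
        exact absurd (Nat.le_of_dvd hb0 h') (by omega)
      · have h' : (p : ℤ) ∣ (n : ℤ) := by
          have : (n : ℤ) = ((n : ℤ) - m * p) + m * p := by ring
          rw [this]
          exact dvd_add h (Dvd.intro_left _ rfl)
        exact hnd (by exact_mod_cast h')
  exact cell_brick_shift_c1 hC hn1 hpr hnd hpB hsq85 (by omega) m hx0 hx1 hw

end Summit.KontsevichZagierPeriods.Zeta5Search.RayC1
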